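import Literature.NumberTheory.Automorphic.FontaineMazurGL2PotCrystallineOrdinary
import Literature.NumberTheory.Automorphic.PotentialAutomorphyCompatibleSystemGL2Rational
import HarnessLib

/-!
# Potential automorphy of two-dimensional `p`-adic representations of a totally real field,
# potentially crystalline and ordinary of Hodge–Tate weights `{0,1}` at `p` — EVERY prime `p`,
# NO hypothesis on the residual image (Thorne 2026, Theorem B)

Topic `Literature/NumberTheory/Automorphic`; companion of `FontaineMazurGL2PotCrystallineOrdinary`
(Thorne's Theorem D over `ℚ`, same local vocabulary) and of
`PotentialAutomorphyCompatibleSystemGL2Rational` (Taylor–Dieulefait, whose HYPOTHESIS is the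
potential-automorphy clause this file CONCLUDES, in the same rendering).  One NAMED FACT
(D-0014), `Thorne2026_potentialAutomorphy_GL2_potCrystallineOrdinary`, no discharge (irreducibly
XL: depth-`C` modularity lifting theorem 4.1, geometry-of-numbers construction of ordinary HBAV
approximants 3.2, Moret-Bailly).

## The printed theorem (J. A. Thorne, *Towards the Fontaine–Mazur conjecture for `GL₂`*,
## arXiv:2608.07186, 7 Aug 2026 [Thorne2026FontaineMazurGL2]; held text, page-checked)

* **Theorem B** (Introduction, p. 2, lines 9–19 of the held text; restated verbatim as
  **Theorem 5.1**, §5 "Deduction of Theorem B", pp. 37–38): "Let `F` be a totally real number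
  field, let `p` be a prime, and let `ρ : G_F → GL₂(ℚ̄_p)` be a continuous, irreducible
  representation satisfying the following conditions: (1) `ρ` is unramified at all but finitely
  many places. (2) For each place `v | p` of `F`, `ρ|_{G_{F_v}}` is potentially crystalline and
  ordinary of Hodge–Tate weights `{0,1}`. (3) `det ρ` is totally odd.  Then `ρ` is potentially
  modular, in the sense that there is a finite totally real extension `F′/F`, an isomorphism
  `ι : ℚ̄_p → ℂ`, and a cuspidal, regular algebraic automorphic representation `π` of `GL₂(𝔸_{F′})`
  such that `ρ|_{G_{F′}} ≅ r_{π,ι}`."  No hypothesis on `p` (the paper stresses `p = 2`) nor on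
  `ρ̄` ("Theorem B applies in particular when the semisimple residual representation `ρ̄` is
  reducible", p. 2).
* **§1.1 Notation** (p. 4): "A representation `ρ : G_{F_v} → GL₂(ℚ̄_p)` is ordinary with
  Hodge–Tate weights `{0,1}` if there is an isomorphism `ρ ∼ ( ψ₁ ∗ ; 0 ε⁻¹ψ₂ )`, where
  `ψ₁, ψ₂ : G_{F_v} → ℚ̄_p^×` are finitely ramified characters (any such representation is de
  Rham, with `HT_τ(ρ) = {0,1}` for any `τ`)"; `HT_τ(ε) = {−1}`.
* **What the statement does NOT say about `F′`** (recorded because consumers ask): Theorem B /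
  5.1 give an ARBITRARY finite totally real `F′/F` and ONE `ι`.  Only the PROOF (p. 38) shows
  more: `F′ = F₁ ⊇ F₀ ⊇ F` with `F₀/F` a totally real extension over which `WD(ρ|_{G_{F₀,v}})` is
  semistable at every finite `v` and `[F₀:ℚ]`, `|Σ₀|` are even ("possible by (the proof of)
  [NT23, Lemma 5.1]") — so `F₀/F` is RAMIFIED above `p` as soon as some `ψᵢ|_{I_v} ≠ 1` — and
  `F₁/F₀` an `S₀`-split totally real extension from Theorem 3.2 (`S₀ ⊇` the `p`-adic places of
  `F₀`; Theorem 3.2 (1), p. 12: "each place `v ∈ Σ` or `v | p` splits in `F′`"; proof, p. 19–20: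
  "we can moreover require that `F′/F` is linearly disjoint from any given finite extension of `F`
  (see e.g. [BLGGT14, Proposition 3.1.1])").  Neither "`F′` Galois over `ℚ`" nor "`∀ ι`" is
  printed anywhere in the paper.  None of this proof-level freedom is rendered here.

## Rendering in the tree's vocabulary (read before reviewing)

* `ρ` continuous, irreducible, (1), (3): `ρ : FramedGaloisRep F (PadicAlgCl p) 2`,
  `ρ.toGaloisRep.IsIrreducible`, `∀ᶠ v in cofinite, ρ.IsUnramifiedAt v`, `ρ.IsOdd` (`det ρ(c) = −1`
  for the complex conjugations of EVERY real embedding: totally odd) — verbatim the clauses of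
  the companion facts.
* (2): VERBATIM the local clause of `Thorne2026_fontaineMazurGL2_potCrystallineOrdinary` (there
  over `ℚ`), at every `v ∣ p` of `F`: the accepted Skinner–Wiles predicate
  `FramedGaloisRep.IsOrdinaryOfWeightAt p ρ v 2 m` with some inertial exponent `m ≥ 1`
  (`ρ|_{Γ_{F_v}} ≅ ( ψ₁ε ∗ ; 0 ψ₂ )` after a change of frame, `ψᵢ|_{I_v}` killed by `m`, i.e.
  finitely ramified — so `ρ ⊗ ε⁻¹|_{Γ_{F_v}} ≅ ( ψ₁ ∗ ; 0 ε⁻¹ψ₂ )` is EXACTLY "ordinary of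
  Hodge–Tate weights `{0,1}`" in Thorne's sense, and conversely up to the Tate twist `ε`), plus
  potential crystallinity for Fontaine's pinned datum `𝔇 = fontainePstAdicCompletion v p hv`:
  `𝔇.IsDeRhamFramed (ρ.toLocal v) ∧ ∀ r, 𝔇.IsWeilDeligneOf (ρ.toLocal v) r → r.N = 0` (the de
  Rham conjunct keeps the `N = 0` clause from being vacuous; invariant under Tate twists).  The
  exponent `m` may depend on `v` (finitely many `v ∣ p`; `IsOrdinaryOfWeightAt.of_dvd` makes a
  common one).
* Conclusion "`ρ|_{G_{F′}} ≅ r_{π,ι}` for a cuspidal regular algebraic `π` of `GL₂(𝔸_{F′})`":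
  rendered, as everywhere in this directory (`IsAutomorphicAE`; the hypothesis of
  `TaylorDieulefait_potAutomorphic_mem_weaklyCompatibleSystem_GL2_rat`, byte-for-byte the same
  clause), by the a.e. Satake–Frobenius compatibility of `ρ|_{Γ_{F′}}` (`ρ.restrictField F′`), via
  `ι`, with an `L`-ALGEBRAIC cuspidal `π` of `GL₂(𝔸_{F′})` (`CuspidalAutomorphicRepData 2 F′ hF′`,
  for every admissible level datum `hF′`) having a REGULAR infinity type.  Thorne's theorem is
  applied to `ρ ⊗ ε⁻¹` (irreducible, a.e. unramified, totally odd and potentially crystalline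
  together with `ρ`): `(ρ ⊗ ε⁻¹)|_{G_{F′}} ≅ r_{π,ι}` with `π` regular algebraic (`C`-algebraic),
  and `ρ|_{G_{F′}}` is then the Galois representation of the `L`-algebraic `π ⊗ |det|^{−1/2}`
  (Buzzard–Gee), whose unramified Satake parameters give `charpoly ρ(Frob_w)` at almost all `w` —
  the standing dictionary of `IsAutomorphicAE` (module docstring there).  Only the a.e. unramified
  compatibility is rendered; local–global compatibility at the ramified places and at `p`
  contained in "`≅ r_{π,ι}`" is dropped, which WEAKENS the fact.
* `F′/F` finite totally real: `∃ (F′ : Type) [Field F′] [NumberField F′] [Algebra F F′],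
  IsTotallyReal F′ ∧ …` (a number field that is an `F`-algebra is a finite extension of `F`).
  "an isomorphism `ι`": `∃ ι : PadicAlgCl p ≃+* ℂ` (ONE `ι`, as printed).

## What is NOT here (and why)

* The proof-level freedom in `F′` (previous section) and the "`∀ ι`" form (needs the
  `Aut(ℂ)`-conjugates `^σπ` of regular algebraic cuspidal `π`, `Clozel1990_regularAlgebraic`):
  not printed as theorems; consumers needing them must state them separately.
* Theorems 3.2 / 4.1 (HBAV approximants; depth-`C` modularity lifting): no carrier in the tree
  for `M`-HBAV moduli or "`ρ mod ϖ^C`"-closeness; not needed by the consumers.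
* No discharge (irreducibly XL).
* Consumers: crux `DyadicEisensteinFM` of route `Langlands/DyadicOddResidue` (stmt-Langlands-18741),
  line `ordinary-seed-propagation`, reshape rev L3 of its stub T1′ (a weight-`2` potentially
  crystalline ordinary point of a `2`-adic Eisenstein family over a totally real `F` is made
  potentially automorphic by this fact); the sibling dyadic cruxes over totally real fields.

## References

* J. A. Thorne, *Towards the Fontaine–Mazur conjecture for `GL₂`*, arXiv:2608.07186 (2026),
  Theorem B (p. 2) = Theorem 5.1 (pp. 37–38) and its proof (p. 38), Theorem 3.2 (p. 12) and its
  proof (pp. 18–20), Lemma 4.2 (p. 21), §1.1 (p. 4). [Thorne2026FontaineMazurGL2]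
* C. Skinner, A. Wiles, Publ. Math. IHÉS 89 (1999), §1 (the ordinary shape
  `( ψ₁χ^{k−1} ∗ ; 0 ψ₂ )`, here `k = 2`). [SkinnerWiles1999]
* T. Barnet-Lamb, T. Gee, D. Geraghty, R. Taylor, *Potential automorphy and change of weight*,
  Ann. of Math. 179 (2014), Prop. 3.1.1 (Moret-Bailly with splitting / linear disjointness),
  quoted by Thorne p. 19. [BarnetlambEtAl2014]
* J. Newton, J. A. Thorne, *Adjoint Selmer groups of automorphic Galois representations of
  unitary type*, JEMS 25 (2023), Lemma 5.1 (quoted by Thorne p. 38 for the choice of `F₀`).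
* L. Clozel, *Motifs et formes automorphes* (Ann Arbor 1988), Thm. 3.13 (`^σπ`). [Clozel1990]
-/

noncomputable section

open scoped MatrixGroups Matrix NumberField
open NumberField IsDedekindDomain Field Filter

namespace Literature.NumberTheory.Automorphic

open Literature.NumberTheory.GaloisRepresentations Literature.NumberTheory.PAdicHodge

/-- **Thorne 2026, Theorem B: potential automorphy for `GL₂` over a totally real field at EVERY
prime `p` (including `p = 2`) and for EVERY residual image, for representations potentially
crystalline and ordinary of Hodge–Tate weights `{0,1}` at `p`** (module docstring for the printed
statement and the rendering).  Let `F` be a totally real number field, `p` any prime and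
`ρ : Γ_F → GL₂(ℚ̄_p)` continuous and irreducible, unramified at all but finitely many places,
such that at every place `v ∣ p` the representation `ρ` is Skinner–Wiles-ordinary of weight `2`
with some inertial exponent `m ≥ 1` (`IsOrdinaryOfWeightAt p ρ v 2 m`:
`ρ|_{Γ_{F_v}} ≅ ( ψ₁ε ∗ ; 0 ψ₂ )` with `ψ₁, ψ₂` finitely ramified — i.e. `ρ ⊗ ε⁻¹` is "ordinary
of Hodge–Tate weights `{0,1}`" in Thorne's sense), de Rham for Fontaine's pinned `D_pst` datum and
potentially crystalline (`N = 0` on every Weil–Deligne representation the datum attaches to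
`ρ|_{Γ_{F_v}}`), and totally odd (`det ρ(c) = −1` for every complex conjugation `c`).  Then `ρ` is
POTENTIALLY AUTOMORPHIC: there are a finite totally real extension `F′/F` and ONE isomorphism
`ι : ℚ̄_p ≃ ℂ` such that, for every admissible level datum `hF′`, `ρ|_{Γ_{F′}}` is compatible at
almost all places of `F′`, via `ι`, with an `L`-algebraic cuspidal automorphic representation `π`
of `GL₂(𝔸_{F′})` having a regular infinity type ("`ρ|_{G_{F′}} ≅ r_{π,ι}` for a cuspidal regular
algebraic `π`", a.e. rendering; local–global compatibility at the bad places dropped).  Nothing is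
asserted about `F′` beyond "finite totally real" (the `S`-split / linear-disjointness freedom is in
the PROOF only, see the module docstring), and only one `ι` is provided, exactly as printed.
Named fact (D-0014); users take `(h : Thorne2026_potentialAutomorphy_GL2_potCrystallineOrdinary)`.
-- TODO(general form): the proof-level strengthenings "`F′/F` split at a given finite set of places
-- at which `ρ` is crystalline/unramified and linearly disjoint from a given finite extension"
-- (Thm. 3.2 (1), [BLGGT14, Prop. 3.1.1], [NT23, Lemma 5.1]); the `∀ ι` form via `^σπ`
-- (`Clozel1990_regularAlgebraic`); the Tate-twist-folded hypothesis of the companion Theorem D file.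
[cite: Thorne2026FontaineMazurGL2, Theorem B (Introduction, p. 2 of arXiv:2608.07186) = Theorem 5.1 (§5, pp. 37–38), with §1.1 ("ordinary with Hodge–Tate weights {0,1}")]
[cite: SkinnerWiles1999, §1] -/
def Thorne2026_potentialAutomorphy_GL2_potCrystallineOrdinary : Prop :=
  ∀ (F : Type) [Field F] [NumberField F], IsTotallyReal F →
    ∀ (p : ℕ) [Fact p.Prime] (ρ : FramedGaloisRep F (PadicAlgCl p) 2),
    ρ.toGaloisRep.IsIrreducible →
    (∀ᶠ v : HeightOneSpectrum (𝓞 F) in cofinite, ρ.IsUnramifiedAt v) →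
    (∀ (v : HeightOneSpectrum (𝓞 F)) (hv : ((p : ℕ) : 𝓞 F) ∈ v.asIdeal),
      ∃ m : ℕ, 0 < m ∧ FramedGaloisRep.IsOrdinaryOfWeightAt p ρ v 2 m ∧
        (fontainePstAdicCompletion v p hv).IsDeRhamFramed (ρ.toLocal v) ∧
        ∀ r, (fontainePstAdicCompletion v p hv).IsWeilDeligneOf (ρ.toLocal v) r → r.N = 0) →
    ρ.IsOdd →
    ∃ (F' : Type) (_ : Field F') (_ : NumberField F') (_ : Algebra F F'),
      IsTotallyReal F' ∧ ∃ ι : PadicAlgCl p ≃+* ℂ,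
        ∀ hF' : isCompact_glFiniteIntegralLevel 2 F',
          ∃ π : CuspidalAutomorphicRepData 2 F' hF', π.1.IsLAlgebraic ∧
            (∃ T : InfinityType F' 2, π.1.HasInfinityType T ∧ T.IsRegular) ∧
            SatakeFrobCompatibleAE ι π.1 (ρ.restrictField F')

/-- **The base field itself is an admissible witness shape**: if `ρ` is ALREADY automorphic over
`F` in the rendered sense (one `ι`, every level datum), then the conclusion of
`Thorne2026_potentialAutomorphy_GL2_potCrystallineOrdinary` holds with `F′ := F` — the
restriction `ρ.restrictField F` along `Γ_F → Γ_F` (`Algebra.id`) is a conjugate of `ρ`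
(`absGaloisRestrict_isConj_of_algHom_holds` with the identity embedding), and a.e.
Satake–Frobenius compatibility is invariant under conjugation (`FramedRep.conj`,
`satakeFrobCompatibleAE_conj_iff`).  Sanity lemma certifying that the `∃ (F′ …) [Algebra F F′]`
packaging is inhabited by the degenerate case; pure bookkeeping. [folklore] -/
theorem Thorne2026_potentialAutomorphy_GL2_potCrystallineOrdinary.conclusion_of_self
    {F : Type} [Field F] [NumberField F] (hF : IsTotallyReal F) {p : ℕ} [Fact p.Prime]
    (ρ : FramedGaloisRep F (PadicAlgCl p) 2) (ι : PadicAlgCl p ≃+* ℂ)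
    (h : ∀ hF' : isCompact_glFiniteIntegralLevel 2 F,
      ∃ π : CuspidalAutomorphicRepData 2 F hF', π.1.IsLAlgebraic ∧
        (∃ T : InfinityType F 2, π.1.HasInfinityType T ∧ T.IsRegular) ∧
        SatakeFrobCompatibleAE ι π.1 ρ) :
    ∃ (F' : Type) (_ : Field F') (_ : NumberField F') (_ : Algebra F F'),
      IsTotallyReal F' ∧ ∃ ι : PadicAlgCl p ≃+* ℂ,
        ∀ hF' : isCompact_glFiniteIntegralLevel 2 F',
          ∃ π : CuspidalAutomorphicRepData 2 F' hF', π.1.IsLAlgebraic ∧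
            (∃ T : InfinityType F' 2, π.1.HasInfinityType T ∧ T.IsRegular) ∧
            SatakeFrobCompatibleAE ι π.1 (ρ.restrictField F') := by
  -- `res : Γ_F → Γ_F` along `Algebra.id` is conjugation by some `τ`
  obtain ⟨τ, hτ⟩ := absGaloisRestrict_isConj_of_algHom_holds F F (AlgHom.id F (AlgebraicClosure F))
    id (fun σ x => rfl)
  refine ⟨F, inferInstance, inferInstance, inferInstance, hF, ι, fun hF' => ?_⟩
  obtain ⟨π, hL, hT, hc⟩ := h hF'
  refine ⟨π, hL, hT, ?_⟩
  have e : ρ.restrictField F = FramedRep.conj (ρ τ)⁻¹ ρ := by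
    refine ContinuousMonoidHom.ext fun σ => ?_
    have h1 : absGaloisRestrict F F σ = τ⁻¹ * σ * τ :=
      calc absGaloisRestrict F F σ = τ⁻¹ * (τ * absGaloisRestrict F F σ * τ⁻¹) * τ := by group
        _ = τ⁻¹ * σ * τ := by rw [← hτ σ]; rfl
    rw [FramedGaloisRep.restrictField_apply, FramedRep.conj_apply, h1, map_mul, map_mul, map_inv,
      inv_inv]
  rw [e, satakeFrobCompatibleAE_conj_iff]
  exact hc

end Literature.NumberTheory.Automorphic

end
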